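import Mathlib
import HarnessLib
import HarnessLib.Audit
import Summits.AtomisticToContinuum.Statement
import Literature.MathematicalPhysics.StatisticalMechanics.LennardJonesClusters
import Literature.MathematicalPhysics.StatisticalMechanics.HaggStacking
import Literature.MathematicalPhysics.StatisticalMechanics.BarlowStacking

/-!
Route: LaminarKissing

CLOSED (retired) 2026-08-15T13:43:49Z by operator:999:1257524 — reason: not-a-thesis: assembly does not conclude the sub-problem Statement — note: D-0027 §2.1 audit (human 2026-08-15: routes that do not decide the summit are removed): the assembly concludes `Literature.MathematicalPhysics.StatisticalMechanics.Crystallization`, not the sub-problem statement; a NEW conforming route may be opened from the same idea (generated `closes : … → _root_. The file is kept as the record of this route; refuted decls are indexed as negative knowledge (`ledger negatives`).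

# Route LaminarKissing — laminar kissing numbers 6+3+3 — planar caps and hollow pigeonhole make
laminar LJ ground states Barlow, without Hales

It suffices to show X = LaminarBarlowWindows: for every window radius R and tolerance ε, in every
sequence of
Lennard-Jones ground states in ℝ³ all but o(N) particles have their R-neighbourhood ε-matched both
ways, after a rigid
motion, to a window of SOME Barlow stacking `barlowStacking a h s` (per-particle spacings a, h ∈
(1/2, 2), any Hägg word s).
The route realises card laminar-kissing-6-3-3: X is fed by three cruxes — LjLaminarity (zero density
of particles whose
window is not a union of thin parallel layers), LaminarSaturation (inside the laminar class the
energy forces 6 + 3 + 3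
soft bonds with ε-sharp lengths; the coordination CAP is the planar kissing number 6 plus the
inter-layer hollow number 3,
not the 3-D twelve-cap) and LaminarRigidity (a saturated laminar window IS a Barlow window: planar
angle/Gauss–Bonnet
bookkeeping plus a 3-of-6 hollow pigeonhole, no Hales shell classification). Given X,
Crystallization follows from the
shared stacking-fault bound (0759) — one hcp window per N already gives IsCrystallizing as audited —
and the shared
energetic items 0627/0626.
Lean: `∀ R ε : ℝ, 0 < R → 0 < ε → ε < 1 / 4 → ∀ x : (N : ℕ) → (Fin N → EuclideanSpace ℝ (Fin 3)), (∀
N, Literature.MathematicalPhysics.StatisticalMechanics.IsGroundState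
Literature.MathematicalPhysics.StatisticalMechanics.lennardJones (x N)) → Filter.Tendsto (fun N : ℕ
=> (Nat.card {i : Fin N // ¬ (∃ a h : ℝ, 1 / 2 < a ∧ a < 2 ∧ 1 / 2 < h ∧ h < 2 ∧ ∃ s : ℤ → ℤ,
Literature.MathematicalPhysics.StatisticalMechanics.IsHaggSeq s ∧ ∃ z ∈
Literature.MathematicalPhysics.StatisticalMechanics.barlowStacking a h s, ∃ A : EuclideanSpace ℝ
(Fin 3) →ₗᵢ[ℝ] EuclideanSpace ℝ (Fin 3), (∀ p ∈
Literature.MathematicalPhysics.StatisticalMechanics.barlowStacking a h s, dist p z ≤ R → ∃ j : Fin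
N, dist (x N j) (x N i + A (p - z)) ≤ ε) ∧ (∀ j : Fin N, dist (x N j) (x N i) ≤ R → ∃ p ∈
Literature.MathematicalPhysics.StatisticalMechanics.barlowStacking a h s, dist (x N j) (x N i + A (p
- z)) ≤ ε))} : ℝ) / N) Filter.atTop (nhds 0)`

## Assembly
Pure logic plus two library facts, checked sorry-free in the planner's SketchTest.lean (axioms
propext/choice/Quot.sound):
BarlowToHcpWindows applied to X and StackingFaultBound gives one hcp window per large N;
HcpWindowsCrystallize with the
discharged fact LennardJonesMinimalDistance_holds gives IsCrystallizing lennardJones 3;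
CrysPeriodicMinAttained gives a
least periodic P and IsLeast.csInf_eq rewrites the limit of CrysEnergyLimit to e(P), i.e.
HasPeriodicGroundStateEnergy;
the conjunction is Crystallization. The laminar cruxes enter through the glue LaminarToBarlow
(LjLaminarity →
LaminarSaturation → LaminarRigidity → X).

Rationale: WHY THIS LINE. Every kissing-heritage route on file caps coordination in 3-D (Flyspeck L12,
Tammes-13): that cap bites only for bond-length
windows ρ/d < 1.045 (MusinTarasov2012; grounder/refuter notes on 0750) and its equality analysis is
Hales's shell
classification, whose slack version (0758) is threatened by flexible shells
(KusnerKusnerLagariasShlosman2018,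
BoroczkySzabo2016). Split along a foliation instead: for a particle in a thin layer of a layered
configuration the
neighbours come as ≤ 6 in-plane (seven points pairwise ≥ d do not fit within radius < d/(2 sin π/7)
= 1.152 d), ≤ 3 in
the layer above and ≤ 3 below (four points pairwise ≥ d need a disc of radius ≥ d/√2, so ρ² < h² +
d²/2, i.e.
ρ/d < 1.080 at the ideal spacing) — the η = 0 case is Hales's own count 12 ≤ 6 + 3 + 3 (HalesDSP2012
§1.3), PROVED in-tree
(`LayerShells.lean`, `LayerStackings.lean`); equality then propagates by two planar arguments:
degree-6 bond graphs with
edge ratio < 1.10 are triangulated (angle bookkeeping = discrete Gauss–Bonnet, LucaFriesecke2016 Thm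
2.1, Harborth1974,
HeitmannRadin1980) and three occupied hollows among the six around an upper-layer site, no two
edge-adjacent, are
alternate, so each layer pair carries one Hägg letter (ConwaySloane1999 Ch. 1). Imported areas:
planar discrete geometry
(penny-packing/Euler), geometric rigidity (FrieseckeJamesMuller2002, Schmidt2009) for the metric
upgrade, 1-D Hägg
lattice gas for the delegated stacking selection (0759/0737). What it adds: a cap valid at LJ's real
bond spread
(a* = 0.971, not 1), a Hales-free equality chain, and an assembly through ONE hcp window per N
(Blanc–Lewin (16) is
local) instead of the vertex-transitive single-P hinge 0751; the frustration barriers are isolated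
in ONE crux (laminarity).

RANKED CRUXES. #0 LaminarBarlowWindows (target) — X — for all R, ε ∈ (0, 1/4) and every sequence of
LJ ground states, the fraction of particles i whose R-window is not ε-matched both ways (after x ↦
x_i + A(· − z), A a linear isometry, z a stacking point) to barlowStacking a h s for some a, h ∈
(1/2, 2) and Hägg sequence s tends to 0 (same matching predicate as 0759). (why it might fail: False
iff a positive fraction of bulk particles of large LJ ground states sits in non-Barlow environments
(icosahedral/decahedral/bcc-like/amorphous); putative LJ_N minima are icosahedral or decahedral for
N in the thousands (DoyeCalvo2002) and the N → ∞ crossover is unproved.) [DoyeCalvo2002, Doye2000,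
BlancLewin2015, HalesDSP2012, PartayOrtnerCsanyi2017]
#2 LjLaminarity (crux) — LAMINARITY (card K5', shared hypothesis class with card
chessboard-on-particle-planes R4): for every thickness t > 0 and radius R, in every sequence of LJ
ground states the fraction of particles i for which there is NO unit normal n and levels c : ℤ → ℝ
with consecutive gaps ≥ 3/4 such that every particle within R of x_i lies within t of a level plane
tends to 0. [difficulty: open-problem] (why it might fail: Icosahedral and Marks-decahedral motifs
(no single close-packed plane family through a window at a five-fold axis or an icosahedral centre)
dominate LJ_N minima up to N ~ 10³–10⁵; nothing on file bounds the density of polytetrahedral order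
or grain boundaries as N → ∞.) [DoyeCalvo2002, Doye2000, BlancLewin2015,
Literature.Barriers.AtomisticToContinuum.IcosahedralClusters,
Literature.Barriers.AtomisticToContinuum.TetrahedralFrustration, PartayOrtnerCsanyi2017]
#3 LaminarSaturation (crux) — ENERGY STEP IN THE LAMINAR CLASS (card K4' with the caps K1'):
LjLaminarity implies that for every R ≥ 2 and ε > 0, in every sequence of LJ ground states all but
o(N) particles i have a GOOD window: bond lengths a (in-plane) and b (inter-layer) in [19/20, 1], a
unit normal, levels with gaps ≥ 39/50, a level index l with every particle within R of x_i within ε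
of its level, pairwise distances ≥ 19/20 on the window, and for every particle j within R/2 of x_i
exactly 6 same-level, 3 next-level-up and 3 next-level-down particles within distance 1, each such
bond ε-close to a resp. b. Mechanism: laminar caps (LaminarKissingCap) ⇒ ≤ 12 soft bonds per laminar
particle; E = −(1/12)#bonds + elastic + tail and E(N) ≤ N e(hcp) + O(N^(2/3)) force saturation and
ε-sharpness off o(N) particles, the non-laminar o(N) being paid for by LjLaminarity and LJ
stability. [deps: LjLaminarity] [difficulty: XL] (why it might fail: The r⁻⁶ tail (≈30% of e*) is
not bond-local (LocalizedPotentialsExcludeLennardJones): a compressed or square-buckled laminar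
layer (the confined-sphere sequence △→□ of Pieranski 1983 / Schmidt–Löwen 1996) might beat 6+3+3 in
localised energy, and ε-sharpness needs elastic coercivity on top.) [LucaFriesecke2016, Theil2006,
HeitmannRadin1980, Stillinger2001, SchwerdtfegerBurrowsSmits2021, doi:10.1103/PhysRevLett.76.4552,
doi:10.1103/PhysRevLett.50.900,
Literature.Barriers.AtomisticToContinuum.LocalizedPotentialsExcludeLennardJones]
#4 LaminarRigidity (crux) — LAMINAR RIGIDITY (card K2'+K3', pure geometry, no potential): there is
C(R) such that for R ≥ 8 and 0 < ε ≤ 1/250, every GOOD window (as in LaminarSaturation) of any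
finite configuration is, on radius R/4, C(R)·ε-matched both ways after a rigid motion to
barlowStacking a h s for some a, h ∈ (1/2, 2) and Hägg sequence s. Route: in-layer bond graphs are
planar (ρ < √2 d) with all degrees 6 and triangle angles ≥ 2 arcsin(19/40) = 56.7°, so
non-triangular faces cannot close up (5·56.7° + 90° > 360°: angle bookkeeping / discrete
Gauss–Bonnet) ⇒ triangulated ⇒ triangular-lattice patch; the 3 upper partners form a face (hollow);
around an upper site the 3 occupied faces among 6 are pairwise non-edge-adjacent (lens diameter 0.85
< 19/20) hence alternate ⇒ one Hägg letter per layer pair ⇒ combinatorial Barlow; ε-sharp lengths +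
ε-flat layers + discrete Friesecke–James–Müller ⇒ C(R)ε-closeness. η = 0 ancestor proved in-tree:
IsTwelveConfig.eq_layerShell, exists_barlowStacking_subset. [difficulty: L] (why it might fail: Thin
margins at the filed constants: in-layer triangulation needs 5·α_min > 270° (ρ/d < 1.10 before
thickness corrections), the registry lens is 0.85 wide vs d = 0.95; one saturated laminar window
with a registry wall or a quadrilateral face refutes it as stated (repair: tighter constants).)
[HalesDSP2012, LucaFriesecke2016, FrieseckeJamesMuller2002, Schmidt2009, ConwaySloane1999,
Hales2012]
#9 StackingFaultBound (support) — shared verbatim with item 0759 (route CrystalKissingRigidity):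
non-hcp Barlow windows number ≤ C(R, ε)·N^(2/3) in every N-particle LJ ground state (each misaligned
layer pair costs ≥ |J₂| − Σ_(k≥3) k|J_k| > 0 per column by Hägg domination 0737 with certified
couplings, against an O(N^(2/3)) surface budget). The stacking selection of this route is entirely
delegated to it. [difficulty: XL] [PartayOrtnerCsanyi2017, Stillinger2001, LoachAckland2017,
RadinSchulman1983]
#9 CrysPeriodicMinAttained (support) — shared verbatim with item 0627: the infimum of the LJ energy
per particle over periodic configurations of ℝ³ is attained (conjunct (i); crux of routes
CrystalLocalRigidity / RefuteCrystalPeriodicMin / CrystalKissingRigidity, named minimiser in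
PoissonBesselStacking). [difficulty: XL] [BlancLewin2015, BeterminSamajTravenec2022]
#9 CrysEnergyLimit (support) — shared verbatim with item 0626: E(N)/N → ⨅ over periodic
configurations of the LJ energy per particle (thermodynamic-limit bookkeeping: periodisation 0715,
trial blocks 0629, stability). [difficulty: M] [BlancLewin2015]
#9 LaminarKissingCap (support) — THE LAMINAR KISSING CAP (card K1', the namesake): for a particle j
of a finite configuration with a unit normal n, levels c with gaps ≥ 39/50 and a level index l such
that every particle within distance 1 of x_j is within 1/250 of its level, and pairwise distances ≥
19/20 among j and those particles: at most 6 same-level, at most 3 level-up, at most 3 level-down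
particles within distance 1, and none two or more levels away. Proof: horizontal distances ≥
√(0.9025 − 0.008²) and seven directions pairwise ≥ 56.7° apart do not fit in 360°; level-up partners
project into a disc of radius √(1 − 0.772²) = 0.636 < (19/20)/√2 = 0.672, and among four points of a
disc two subtend ≤ 90° at the centre; 2·39/50 − 2/250 > 1. [difficulty: provable-now] [HalesDSP2012,
MusinTarasov2012, Hales2012, Harborth1974]
#9 LaminarToBarlow (support) — GLUE of the laminar layer: LjLaminarity → LaminarSaturation →
LaminarRigidity → LaminarBarlowWindows (apply saturation at R' = max(4R, 8), ε' = min(ε / max(C R',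
1), 1/250), then rigidity; matching is monotone in radius and tolerance; fractions add).
[difficulty: S] [BlancLewin2015]
#9 BarlowToHcpWindows (support) — COUNTING GLUE: LaminarBarlowWindows and the stacking-fault bound
(non-hcp Barlow windows are ≤ C(R,ε) N^(2/3)) give, for all R, ε ∈ (0,1/4) and every ground-state
sequence, EVENTUALLY IN N at least one particle whose R-window is ε-matched to hcpStacking a h for
some a, h ∈ (1/2, 2) (N − o(N) − C N^(2/3) > 0). [difficulty: provable-now] [BlancLewin2015,
PartayOrtnerCsanyi2017]
#9 HcpWindowsCrystallize (support) — SOFT ASSEMBLY LEMMA (replaces the single-P hinge 0751/0752): if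
for all R, ε every ground-state sequence eventually has one particle with an (R, ε)-hcp window, then
(with the uniform minimal distance of LJ ground states) IsCrystallizing lennardJones 3: centre at
that particle (τ = −x_i), diagonalise over R_k = k, ε_k = 1/k, extract convergent (a, h) ∈ [1/2,2]²,
isometries A in O(3) and the finitely many pointed patterns hcpStacking − z; minimal distance makes
the ε-matching a bijection on supp f, so Σ_i f(x_i + τ) → Σ over the isometric image of
hcpPeriodicConfiguration a h (a PeriodicConfiguration, m ≡ 1). Blanc–Lewin (16) is local, so one
window per N suffices. [difficulty: M] [BlancLewin2015]

TWO-LAYER PLAN. Foreseen glued splits (none filed now): LaminarRigidity ⇐ CombinatorialBarlow (slack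
only, no ε: a GOOD window's bond
graph on B_(R/2) is isomorphic, levels to layers, to a window of the contact graph of barlowStacking
1 √(2/3) s) →
MetricUpgrade (combinatorial Barlow + ε-sharp lengths + ε-flat layers ⇒ C(R)ε-matching, discrete
FJM) → LaminarRigidity;
LaminarSaturation ⇐ LaminarLocalEnergyInequality (a localised energy e_loc ≥ e_lam with a gap γ at
laminar sites that are
not 6+3+3, caps from LaminarKissingCap, two-shell tail accounting) → BudgetCount (E(N) ≤ N e(hcp) +
C N^(2/3), LJ
stability for the non-laminar o(N)) → LaminarSaturation. LjLaminarity is not decomposed: it is the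
bet, shared with the
chessboard card's class.

KILL CRITERIA. LjLaminarity refuted (a positive fraction of non-laminar bulk particles in LJ ground
states, e.g. persistent polytetrahedral
order) closes the route `refuted:LjLaminarity` and retires the laminar hypothesis class (cards
laminar-kissing-6-3-3,
chessboard-on-particle-planes R4). LaminarSaturation refuted under laminarity (laminar bulk with a
positive fraction of
non-6+3+3 sites at ground-state energy) closes the route. LaminarRigidity refuted by an explicit
saturated laminar window
that is not Barlow forces a RESTATE with tighter constants (19/20, 1, 39/50, 1/250 are tunable), not
a closure, unless the
witness works at every slack. StackingFaultBound refuted (positive stacking-fault density) ⇒ pivot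
BarlowToHcpWindows to
"some periodic Barlow window recurs" or, if optimal stackings are aperiodic, the conjunct itself is
in doubt (route
RefuteCrystalPeriodicMin). 0627 refuted kills conjunct (i) for every route. SoftTwelveCoordination
(0750) + 0758 proved
elsewhere would supersede the laminar layer (X follows), not refute it.

NOT DECOMPOSED YET. The localised energy functional and the two-shell tail accounting inside
LaminarSaturation; the elastic coercivity that
turns saturation into ε-sharp windows; the discrete rigidity constants C(R); the combinatorial core
of LaminarRigidity as
its own item; thickness corrections to the angle thresholds; the choice of constants (19/20, 1,
39/50, 1/250), which a
tenure pass may retune by restate; the periodic analogue for conjunct (i) (delegated to 0627). All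
wait for crux 2 or 4.

CHEAPEST FALSIFIER. Arithmetic of the caps, done here: in-plane 7 × 2 arcsin(0.94997/2) = 397° >
360°; inter-layer disc radius
√(1 − 0.772²) = 0.636 < 0.95/√2 = 0.672; next-nearest level 2·0.78 − 0.008 = 1.552 > 1 —
LaminarKissingCap holds at the
filed constants. The cheapest REAL test is numerical and was not run (one-shot seat, no kit job):
quench periodic-boundary
LJ (N ≈ 10⁴) from the melt and measure, in the inherent structures, the fraction of particles
failing laminarity
(t = 0.05, R = 2.5) and of laminar particles failing 6+3+3 within ρ = 1.03 a*, against anneal depth;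
a plateau at a
positive fraction for the best anneals embarrasses LjLaminarity / LaminarSaturation (not a proof
either way). For
LaminarRigidity: a two-layer Monte-Carlo search for a saturated laminar window with a quadrilateral
face or a registry
wall at (d, ρ, gap, t) = (0.95, 1, 0.78, 0.004).

NUMBERS. LJ close-packed bulk: nearest-neighbour distance a* = (C₁₂/C₆)^(1/6) =
(12.132/14.454)^(1/6) = 0.9713, layer gap
h* = a*√(2/3) = 0.7931 (Stillinger2001, SchwerdtfegerBurrowsSmits2021); filed window: bonds in
[0.95, 1] (−2.2 % / +3.0 %),
gaps ≥ 0.78, thickness ≤ ε ≤ 0.004. Cap validity as bond-window ratio ρ/d: 3-D twelve-cap (Tammes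
13, MusinTarasov2012)
1.0455; laminar inter-layer cap √(2/3 + 1/2) = 1.0801 at ideal spacing (card's "6.2 %" used h =
0.81; at d = 0.97,
h = 0.792 the honest figure is 4.8 % vs 1.4 %); in-plane cap 1/(2 sin π/7) = 1.1524; in-layer
triangulation threshold
1/(2 sin 27°) = 1.1013; registry lens 2√(0.636² − 0.475²) = 0.846 < 0.95. LJ_N structural
crossovers: "energetic
crossovers occur for clusters with thousands of atoms" (DoyeCalvo2002 p. 8); |J₂| ≈ 7.3e−5, ratio ≥
287 (route
PoissonBesselStacking numerics) behind 0759. Items at open: 12 (target, 3 cruxes, 7 support,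
assembly).

DEFINITION REQUESTS. None required: every statement is inlined over existing declarations
(IsGroundState, lennardJones, IsHaggSeq,
barlowStacking, hcpStacking, LennardJonesMinimalDistance, IsCrystallizing, PeriodicConfiguration).
Optional later, to
shorten signatures: Theorems-side predicates `LaminarWindow x i R t` and `GoodLaminarWindow x i R ε`
(topic
Summits/AtomisticToContinuum/Crystallization/Theorems).

Novelty: Searches (2026-08-15): `lit frontier AtomisticToContinuum --since 2020` (30 rows;
crystallization-relevant: arXiv:2407.20762
plane/arbitrary norm, arXiv:2604.19239 rigid polycrystals 2-D — no layered 3-D argument); `lit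
bridges AtomisticToContinuum
--cross any` (30 rows, none on packing/crystallization); `lit galaxy search "three in the layer
above" --star all` (10
panama textbook hits, e.g. panama:400351081529390 Wahab, Solid State Physics — the 6+3+3 DESCRIPTION
of close packing;
pdf/crabby 0); `lit galaxy search "close-packed layers kissing number" --star all` (0); zbMATH
`crystallization
Lennard-Jones` ≥ 2012 (10: arXiv:1605.00034, Bétermin family, arXiv:2506.22614,
doi:10.1016/j.na.2022.113046 — all 2-D or
lattice-restricted), `Friedrich Kreutz crystallization` (4: arXiv:2209.14880 stratification proof,
square lattice 2-D),
`kissing number slab` / `crystallization multilayer stacking` / `confined hard spheres buckling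
triangular square` (0 each);
local hybrid `Harborth unit distance contact number` (Hales DSP p. 13, Croft–Falconer–Guy pp.
171–173, Conway–Sloane);
OpenAlex / Semantic Scholar / arXiv API were rate-limited (HTTP 429) in this session; the card's two
refuter audits
(refuter-10, refuter-14) searched the same space and found only the description direction plus the
confined-bilayer
buckling physics (Pieranski–Strzelecki–Pansu 1983, Schmidt–Löwen 1996).
Nearest prior art found: HalesDSP2012 §1.3 = in-tree `LayerShells.lean` / `LayerStackings.lean` (η =
0: twelve  [refs: 10.1016/j.na.2022.113046, 10.1103/PhysRevLett.76.4552, 2407.20762, 2604.19239, 1605.00034, 2506.22614, 2209.14880, doi:10.1016/j.na.2022.113046, doi:10.1103/PhysRevLett.76.4552, HalesDSP2012, FriedrichKreutz2023, LucaFriesecke2016]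

Barriers (technique_class: laminar-kissing-cap planar-gauss-bonnet hollow-pigeonhole): - technique_class: laminar-kissing-cap planar-gauss-bonnet hollow-pigeonhole
- Literature.Barriers.AtomisticToContinuum.FlexibleKissingArrangements: evaded by hypothesis — a
laminar shell is 6 (coplanar, pairwise ≥ d, within ρ < 1.10 d: angularly rigid up to ±3.5°) + 3 + 3;
the flexible icosahedral/dodecahedral shells have no centred planar hexagon and are excluded
upstream by LjLaminarity, where this barrier is conceded to live.
- Literature.Barriers.AtomisticToContinuum.KissingTwelveDegeneracy: respected — LaminarRigidity
outputs "Barlow, any Hägg word" (X quantifies ∃ s); the stacking is selected only through the shared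
tail-driven item 0759 (J_k beyond the second shell), never by contacts.
- Literature.Barriers.AtomisticToContinuum.ShortRangeStackingBlindness: respected for the same
reason; no selection is claimed from bonds ≤ ρ.
- Literature.Barriers.AtomisticToContinuum.TetrahedralFrustration: it does not evade it; the bet is
that frustration is confined to LjLaminarity (crux 2) — inside a thin layer planar 6-kissing is
unfrustrated (the hexagon tiles), which is exactly why the caps and the equality chain are
two-dimensional.
- Literature.Barriers.AtomisticToContinuum.IcosahedralClusters: same — LJ₁₃-type icosahedral centres
are non-laminar; their zero density as N → ∞ is the content of crux 2, paid for in
LaminarSaturation's budget by LJ stability, not excluded by the caps.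
- Literature.Barriers.AtomisticToContinuum.LocalizedPotentialsExcludeLennardJones: applies to La

History (route lifecycle, newest last):
- 2026-08-15T13:43:50Z · CLOSED retired — not-a-thesis: assembly does not conclude the sub-problem Statement (operator:999:1257524)

sub-problem: Crystallization · status: closed(retired) · opened planner-plancard-AtomisticToContinuum-Crystal-07c530d0-0 2026-08-15T11:34:30Z · rev 0 · ledger route-AtomisticToContinuum-LaminarKissing
GENERATED by the gate from the ledger (D-0016/17). Provers cite these decls: `theorem foo : Summit.AtomisticToContinuum.Crystallization.Theses.LaminarKissing.<Decl> := …` in Summits/AtomisticToContinuum/Crystallization/Theorems/<Name>.lean.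
-/

namespace Summit.AtomisticToContinuum.Crystallization.Theses.LaminarKissing

open scoped BigOperators Topology Manifold Classical MeasureTheory ProbabilityTheory Matrix InnerProductSpace ComplexConjugate ContinuousMap
open Filter Set Function TopologicalSpace MeasureTheory

attribute [summit_statement] _root_.Crystallization

/-- item stmt-AtomisticToContinuum-4548 · target · rank 0 · closed · moot by None · by planner
why it might fail: False iff a positive fraction of bulk particles of large LJ ground states sits in non-Barlow environments (icosahedral/decahedral/bcc-like/amorphous); putative LJ_N minima are icosahedral or decahedral for N in the thousands (DoyeCalvo2002) and the N → ∞ crossover is unproved.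
sources: DoyeCalvo2002, Doye2000, BlancLewin2015, HalesDSP2012, PartayOrtnerCsanyi2017
[target] X — for all R, ε ∈ (0, 1/4) and every sequence of LJ ground states, the fraction of
particles i whose R-window is not ε-matched both ways (after x ↦ x_i + A(· − z), A a linear
isometry, z a stacking point) to barlowStacking a h s for some a, h ∈ (1/2, 2) and Hägg sequence s
tends to 0 (same matching predicate as 0759). -/
@[route_item "route-AtomisticToContinuum-LaminarKissing"]
def LaminarBarlowWindows : Prop :=
  ∀ R ε : ℝ, 0 < R → 0 < ε → ε < 1 / 4 → ∀ x : (N : ℕ) → (Fin N → EuclideanSpace ℝ (Fin 3)), (∀ N, Literature.MathematicalPhysics.StatisticalMechanics.IsGroundState Literature.MathematicalPhysics.StatisticalMechanics.lennardJones (x N)) → Filter.Tendsto (fun N : ℕ => (Nat.card {i : Fin N // ¬ (∃ a h : ℝ, 1 / 2 < a ∧ a < 2 ∧ 1 / 2 < h ∧ h < 2 ∧ ∃ s : ℤ → ℤ, Literature.MathematicalPhysics.StatisticalMechanics.IsHaggSeq s ∧ ∃ z ∈ Literature.MathematicalPhysics.StatisticalMechanics.barlowStacking a h s, ∃ A : EuclideanSpace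 ℝ (Fin 3) →ₗᵢ[ℝ] EuclideanSpace ℝ (Fin 3), (∀ p ∈ Literature.MathematicalPhysics.StatisticalMechanics.barlowStacking a h s, dist p z ≤ R → ∃ j : Fin N, dist (x N j) (x N i + A (p - z)) ≤ ε) ∧ (∀ j : Fin N, dist (x N j) (x N i) ≤ R → ∃ p ∈ Literature.MathematicalPhysics.StatisticalMechanics.barlowStacking a h s, dist (x N j) (x N i + A (p - z)) ≤ ε))} : ℝ) / N) Filter.atTop (nhds 0)

/-- item stmt-AtomisticToContinuum-4549 · crux · rank 2 · closed · moot by None · by planner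
why it might fail: Icosahedral and Marks-decahedral motifs (no single close-packed plane family through a window at a five-fold axis or an icosahedral centre) dominate LJ_N minima up to N ~ 10³–10⁵; nothing on file bounds the density of polytetrahedral order or grain boundaries as N → ∞.
sources: DoyeCalvo2002, Doye2000, BlancLewin2015, Literature.Barriers.AtomisticToContinuum.IcosahedralClusters, Literature.Barriers.AtomisticToContinuum.TetrahedralFrustration, PartayOrtnerCsanyi2017
[crux] LAMINARITY (card K5', shared hypothesis class with card chessboard-on-particle-planes R4):
for every thickness t > 0 and radius R, in every sequence of LJ ground states the fraction of
particles i for which there is NO unit normal n and levels c : ℤ → ℝ with consecutive gaps ≥ 3/4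
such that every particle within R of x_i lies within t of a level plane tends to 0. [difficulty:
open-problem] -/
@[route_item "route-AtomisticToContinuum-LaminarKissing"]
def LjLaminarity : Prop :=
  ∀ t R : ℝ, 0 < t → 0 < R → ∀ x : (N : ℕ) → (Fin N → EuclideanSpace ℝ (Fin 3)), (∀ N, Literature.MathematicalPhysics.StatisticalMechanics.IsGroundState Literature.MathematicalPhysics.StatisticalMechanics.lennardJones (x N)) → Filter.Tendsto (fun N : ℕ => (Nat.card {i : Fin N // ¬ (∃ n : EuclideanSpace ℝ (Fin 3), ‖n‖ = 1 ∧ ∃ c : ℤ → ℝ, (∀ k : ℤ, c k + 3 / 4 ≤ c (k + 1)) ∧ ∀ j : Fin N, dist (x N j) (x N i) ≤ R → ∃ k : ℤ, |inner ℝ (x N j - x N i) n - c k| ≤ t)} : ℝ) / N) Filter.atTop (nhds 0)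

/-- item stmt-AtomisticToContinuum-4550 · crux · rank 3 · closed · moot by None · by planner
why it might fail: The r⁻⁶ tail (≈30% of e*) is not bond-local (LocalizedPotentialsExcludeLennardJones): a compressed or square-buckled laminar layer (the confined-sphere sequence △→□ of Pieranski 1983 / Schmidt–Löwen 1996) might beat 6+3+3 in localised energy, and ε-sharpness needs elastic coercivity on top.
sources: LucaFriesecke2016, Theil2006, HeitmannRadin1980, Stillinger2001, SchwerdtfegerBurrowsSmits2021, doi:10.1103/PhysRevLett.76.4552
[crux] ENERGY STEP IN THE LAMINAR CLASS (card K4' with the caps K1'): LjLaminarity implies that for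
every R ≥ 2 and ε > 0, in every sequence of LJ ground states all but o(N) particles i have a GOOD
window: bond lengths a (in-plane) and b (inter-layer) in [19/20, 1], a unit normal, levels with gaps
≥ 39/50, a level index l with every particle within R of x_i within ε of its level, pairwise
distances ≥ 19/20 on the window, and for every particle j within R/2 of x_i exactly 6 same-level, 3
next-level-up and 3 next-level-down particles within distance 1, each such bond ε-close to a resp.
b. Mechanism: laminar caps (LaminarKissingCap) ⇒ ≤ 12 soft bonds per laminar particle; E =
−(1/12)#bonds + elastic + tail and E(N) ≤ N e(hcp) + O(N^(2/3)) force saturation and ε-sharpness off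
o(N) particles, the non-laminar o(N) being paid for by LjLaminarity and LJ stability. [deps:
LjLaminarity] [difficulty: XL] -/
@[route_item "route-AtomisticToContinuum-LaminarKissing"]
def LaminarSaturation : Prop :=
  LjLaminarity → ∀ R ε : ℝ, 2 ≤ R → 0 < ε → ∀ x : (N : ℕ) → (Fin N → EuclideanSpace ℝ (Fin 3)), (∀ N, Literature.MathematicalPhysics.StatisticalMechanics.IsGroundState Literature.MathematicalPhysics.StatisticalMechanics.lennardJones (x N)) → Filter.Tendsto (fun N : ℕ => (Nat.card {i : Fin N // ¬ (∃ a b : ℝ, 19 / 20 ≤ a ∧ a ≤ 1 ∧ 19 / 20 ≤ b ∧ b ≤ 1 ∧ ∃ n : EuclideanSpace ℝ (Fin 3), ‖n‖ = 1 ∧ ∃ c : ℤ → ℝ, (∀ k : ℤ, c k + 39 / 50 ≤ c (k + 1)) ∧ ∃ l : Fin N → ℤ, (∀ j : Fin N, dist (x N j) (x N i) ≤ R → |inner ℝ (x N j - x N i) n - c (l j)| ≤ ε) ∧ (∀ j k : Fin N, dist (x N j) (x N i) ≤ R → dist (x N k) (x N i) ≤ R → j ≠ k → 19 / 20 ≤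 dist (x N j) (x N k)) ∧ ∀ j : Fin N, dist (x N j) (x N i) ≤ R / 2 → Nat.card {k : Fin N // k ≠ j ∧ l k = l j ∧ dist (x N j) (x N k) ≤ 1} = 6 ∧ Nat.card {k : Fin N // l k = l j + 1 ∧ dist (x N j) (x N k) ≤ 1} = 3 ∧ Nat.card {k : Fin N // l k = l j - 1 ∧ dist (x N j) (x N k) ≤ 1} = 3 ∧ ∀ k : Fin N, k ≠ j → dist (x N j) (x N k) ≤ 1 → (l k = l j → |dist (x N j) (x N k) - a| ≤ ε) ∧ (l k ≠ l j → |dist (x N j) (x N k) - b| ≤ ε))} : ℝ) / N) Filter.atTop (nhds 0)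

/-- item stmt-AtomisticToContinuum-4551 · crux · rank 4 · closed · moot by None · by planner
why it might fail: Thin margins at the filed constants: in-layer triangulation needs 5·α_min > 270° (ρ/d < 1.10 before thickness corrections), the registry lens is 0.85 wide vs d = 0.95; one saturated laminar window with a registry wall or a quadrilateral face refutes it as stated (repair: tighter constants).
sources: HalesDSP2012, LucaFriesecke2016, FrieseckeJamesMuller2002, Schmidt2009, ConwaySloane1999, Hales2012
[crux] LAMINAR RIGIDITY (card K2'+K3', pure geometry, no potential): there is C(R) such that for R ≥
8 and 0 < ε ≤ 1/250, every GOOD window (as in LaminarSaturation) of any finite configuration is, on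
radius R/4, C(R)·ε-matched both ways after a rigid motion to barlowStacking a h s for some a, h ∈
(1/2, 2) and Hägg sequence s. Route: in-layer bond graphs are planar (ρ < √2 d) with all degrees 6
and triangle angles ≥ 2 arcsin(19/40) = 56.7°, so non-triangular faces cannot close up (5·56.7° +
90° > 360°: angle bookkeeping / discrete Gauss–Bonnet) ⇒ triangulated ⇒ triangular-lattice patch;
the 3 upper partners form a face (hollow); around an upper site the 3 occupied faces among 6 are
pairwise non-edge-adjacent (lens diameter 0.85 < 19/20) hence alternate ⇒ one Hägg letter per layer
pair ⇒ combinatorial Barlow; ε-sharp lengths + ε-flat layers + discrete Friesecke–James–Müller ⇒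
C(R)ε-closeness. η = 0 ancestor proved in-tree: IsTwelveConfig.eq_layerShell,
exists_barlowStacking_subset. [difficulty: L] -/
@[route_item "route-AtomisticToContinuum-LaminarKissing"]
def LaminarRigidity : Prop :=
  ∃ C : ℝ → ℝ, ∀ R ε : ℝ, 8 ≤ R → 0 < ε → ε ≤ 1 / 250 → ∀ (N : ℕ) (x : Fin N → EuclideanSpace ℝ (Fin 3)) (i : Fin N), (∃ a b : ℝ, 19 / 20 ≤ a ∧ a ≤ 1 ∧ 19 / 20 ≤ b ∧ b ≤ 1 ∧ ∃ n : EuclideanSpace ℝ (Fin 3), ‖n‖ = 1 ∧ ∃ c : ℤ → ℝ, (∀ k : ℤ, c k + 39 / 50 ≤ c (k + 1)) ∧ ∃ l : Fin N → ℤ, (∀ j : Fin N, dist (x j) (x i) ≤ R → |inner ℝ (x j - x i) n - c (l j)| ≤ ε) ∧ (∀ j k : Fin N, dist (x j) (x i) ≤ R → dist (x k) (x i) ≤ R → j ≠ k → 19 / 20 ≤ dist (x j) (x k)) ∧ ∀ j : Fin N, dist (x j) (x i) ≤ R / 2 → Nat.card {k : Fin N // k ≠ j ∧ l k = l j ∧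 dist (x j) (x k) ≤ 1} = 6 ∧ Nat.card {k : Fin N // l k = l j + 1 ∧ dist (x j) (x k) ≤ 1} = 3 ∧ Nat.card {k : Fin N // l k = l j - 1 ∧ dist (x j) (x k) ≤ 1} = 3 ∧ ∀ k : Fin N, k ≠ j → dist (x j) (x k) ≤ 1 → (l k = l j → |dist (x j) (x k) - a| ≤ ε) ∧ (l k ≠ l j → |dist (x j) (x k) - b| ≤ ε)) → ∃ a h : ℝ, 1 / 2 < a ∧ a < 2 ∧ 1 / 2 < h ∧ h < 2 ∧ ∃ s : ℤ → ℤ, Literature.MathematicalPhysics.StatisticalMechanics.IsHaggSeq s ∧ ∃ z ∈ Literature.MathematicalPhysics.StatisticalMechanics.barlowStacking a h s, ∃ A : EuclideanSpace ℝ (Fin 3) →ₗᵢ[ℝ] EuclideanSpace ℝ (Fin 3), (∀ p ∈ Literature.MathematicalPhysics.StatisticalMechanics.barlowStacking a h s, dist p z ≤ R / 4 → ∃ j : Fin N, dist (x j) (x i + A (p - z)) ≤ C R * ε) ∧ (∀ j : Fin N, dist (x j) (x i) ≤ R / 4 → ∃ p ∈ Literature.MathematicalPhysics.StatisticalMechanics.barlowStacking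 a h s, dist (x j) (x i + A (p - z)) ≤ C R * ε)

/-- item stmt-AtomisticToContinuum-0626 · support · rank 9 · open · by planner
sources: BlancLewin2015
Energetic crystallization: E(N)/N converges to the infimum over periodic (multi-lattice)
configurations of the LJ energy per particle in d = 3. Lower bound liminf ≥ ⨅ is the content ((a)
local optimality + (d) + surface term O(N^{2/3})); upper bound is filed separately. -/
@[route_item "route-AtomisticToContinuum-LaminarKissing"]
def CrysEnergyLimit : Prop :=
  Filter.Tendsto (fun N : ℕ => Literature.MathematicalPhysics.StatisticalMechanics.groundStateEnergy Literature.MathematicalPhysics.StatisticalMechanics.lennardJones 3 N / N) Filter.atTop (nhds (⨅ Q : Literature.MathematicalPhysics.StatisticalMechanics.PeriodicConfiguration 3, Q.energyPerParticle Literature.MathematicalPhysics.StatisticalMechanics.lennardJones))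

/-- item stmt-AtomisticToContinuum-0627 · support · rank 9 · open · by planner
sources: BlancLewin2015, BeterminSamajTravenec2022
The infimum over periodic configurations of ℝ³ of the Lennard-Jones energy per particle is attained
(by some lattice G and finite motif F). Needs stacking selection (c) + compactness of near-optimal
periodic configurations at bounded density / bounded-below distances; refuted if optimal LJ
stackings are aperiodic with unattained infimum (route RefuteCrystalPeriodicMin). -/
@[route_item "route-AtomisticToContinuum-LaminarKissing"]
def CrysPeriodicMinAttained : Prop :=
  ∃ P : Literature.MathematicalPhysics.StatisticalMechanics.PeriodicConfiguration 3, IsLeast (Set.range fun Q : Literature.MathematicalPhysics.StatisticalMechanics.PeriodicConfiguration 3 => Q.energyPerParticle Literature.MathematicalPhysics.StatisticalMechanics.lennardJones) (P.energyPerParticle Literature.MathematicalPhysics.StatisticalMechanics.lennardJones)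

/-- item stmt-AtomisticToContinuum-0759 · support · rank 9 · closed · moot by None · by planner
sources: PartayOrtnerCsanyi2017, Stillinger2001, LoachAckland2017, RadinSchulman1983
[support] STACKING-FAULT BOUND: there is K < ∞ such that every N-particle Lennard-Jones ground state
in ℝ³, read through (K1)+(K2) as a Barlow stacking away from o(N) defective particles, has at most K
misaligned (non-HCP) layer pairs meeting the bulk; because each fault plane crossing the cluster
costs ≥ (|J_2| − Σ_{k≥3} k|J_k|)·c N^{2/3} > 0 (Hägg domination 0716/0737 with the certified
couplings of 0670: J_2 ≈ −7.3e−5, ratio ≈ 250) while the total shape-dependent surface energy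
available is ≤ C N^{2/3}. With ≤ K faults among ≍ N^{1/3} layers, pigeonhole gives fault-free slabs
of ≥ N^{1/3}/(K+1) layers, whence BulkDefectVanish for the HCP-type P. Sources: HaggStacking.lean;
PartayOrtnerCsanyi2017; Stillinger2001. -/
@[route_item "route-AtomisticToContinuum-LaminarKissing"]
def StackingFaultBound : Prop :=
  ∃ C : ℝ → ℝ → ℝ, ∀ R ε : ℝ, 0 < R → 0 < ε → ε < 1 / 4 → ∀ (N : ℕ) (x : Fin N → EuclideanSpace ℝ (Fin 3)), Literature.MathematicalPhysics.StatisticalMechanics.IsGroundState Literature.MathematicalPhysics.StatisticalMechanics.lennardJones x → let M : Set (EuclideanSpace ℝ (Fin 3)) → Fin N → Prop := fun S i => ∃ z ∈ S, ∃ A : EuclideanSpace ℝ (Fin 3) →ₗᵢ[ℝ] EuclideanSpace ℝ (Fin 3), (∀ p ∈ S, dist p z ≤ R → ∃ j : Fin N, dist (x j) (x i + A (p - z)) ≤ ε) ∧ (∀ j : Fin N, dist (x j) (x i) ≤ R → ∃ p ∈ S, dist (x j) (x i + A (p - z)) ≤ ε); (Nat.card {i : Fin N // (∃ a h : ℝ,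 1 / 2 < a ∧ a < 2 ∧ 1 / 2 < h ∧ h < 2 ∧ ∃ s : ℤ → ℤ, Literature.MathematicalPhysics.StatisticalMechanics.IsHaggSeq s ∧ M (Literature.MathematicalPhysics.StatisticalMechanics.barlowStacking a h s) i) ∧ ¬ ∃ a h : ℝ, 1 / 2 < a ∧ a < 2 ∧ 1 / 2 < h ∧ h < 2 ∧ M (Literature.MathematicalPhysics.StatisticalMechanics.hcpStacking a h) i} : ℝ) ≤ C R ε * (N : ℝ) ^ (2 / 3 : ℝ)

/-- item stmt-AtomisticToContinuum-4552 · support · rank 9 · closed · moot by None · by planner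
sources: HalesDSP2012, MusinTarasov2012, Hales2012, Harborth1974
[support] THE LAMINAR KISSING CAP (card K1', the namesake): for a particle j of a finite
configuration with a unit normal n, levels c with gaps ≥ 39/50 and a level index l such that every
particle within distance 1 of x_j is within 1/250 of its level, and pairwise distances ≥ 19/20 among
j and those particles: at most 6 same-level, at most 3 level-up, at most 3 level-down particles
within distance 1, and none two or more levels away. Proof: horizontal distances ≥ √(0.9025 −
0.008²) and seven directions pairwise ≥ 56.7° apart do not fit in 360°; level-up partners project
into a disc of radius √(1 − 0.772²) = 0.636 < (19/20)/√2 = 0.672, and among four points of a disc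
two subtend ≤ 90° at the centre; 2·39/50 − 2/250 > 1. [difficulty: provable-now] -/
@[route_item "route-AtomisticToContinuum-LaminarKissing"]
def LaminarKissingCap : Prop :=
  ∀ (N : ℕ) (x : Fin N → EuclideanSpace ℝ (Fin 3)) (j : Fin N) (n : EuclideanSpace ℝ (Fin 3)) (c : ℤ → ℝ) (l : Fin N → ℤ), ‖n‖ = 1 → (∀ k : ℤ, c k + 39 / 50 ≤ c (k + 1)) → (∀ k : Fin N, dist (x j) (x k) ≤ 1 → |inner ℝ (x k - x j) n - c (l k)| ≤ 1 / 250) → (∀ k k' : Fin N, dist (x j) (x k) ≤ 1 → dist (x j) (x k') ≤ 1 → k ≠ k' → 19 / 20 ≤ dist (x k) (x k')) → Nat.card {k : Fin N // k ≠ j ∧ l k = l j ∧ dist (x j) (x k) ≤ 1} ≤ 6 ∧ Nat.card {k : Fin N // l k = l j + 1 ∧ dist (x j) (x k) ≤ 1} ≤ 3 ∧ Nat.card {k : Fin N // l k = l j - 1 ∧ dist (x j) (x k) ≤ 1} ≤ 3 ∧ ∀ k : Fin N, dist (x j) (x k) ≤ 1 → l j - 1 ≤ l k ∧ l k ≤ l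 j + 1

/-- item stmt-AtomisticToContinuum-4553 · support · rank 9 · closed · moot by None · by planner
sources: BlancLewin2015
[support] GLUE of the laminar layer: LjLaminarity → LaminarSaturation → LaminarRigidity →
LaminarBarlowWindows (apply saturation at R' = max(4R, 8), ε' = min(ε / max(C R', 1), 1/250), then
rigidity; matching is monotone in radius and tolerance; fractions add). [difficulty: S] -/
@[route_item "route-AtomisticToContinuum-LaminarKissing"]
def LaminarToBarlow : Prop :=
  LjLaminarity → LaminarSaturation → LaminarRigidity → LaminarBarlowWindows

/-- item stmt-AtomisticToContinuum-4554 · support · rank 9 · closed · moot by None · by planner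
sources: BlancLewin2015, PartayOrtnerCsanyi2017
[support] COUNTING GLUE: LaminarBarlowWindows and the stacking-fault bound (non-hcp Barlow windows
are ≤ C(R,ε) N^(2/3)) give, for all R, ε ∈ (0,1/4) and every ground-state sequence, EVENTUALLY IN N
at least one particle whose R-window is ε-matched to hcpStacking a h for some a, h ∈ (1/2, 2) (N −
o(N) − C N^(2/3) > 0). [difficulty: provable-now] -/
@[route_item "route-AtomisticToContinuum-LaminarKissing"]
def BarlowToHcpWindows : Prop :=
  LaminarBarlowWindows → StackingFaultBound → ∀ R ε : ℝ, 0 < R → 0 < ε → ε < 1 / 4 → ∀ x : (N : ℕ) → (Fin N → EuclideanSpace ℝ (Fin 3)), (∀ N, Literature.MathematicalPhysics.StatisticalMechanics.IsGroundState Literature.MathematicalPhysics.StatisticalMechanics.lennardJones (x N)) → ∀ᶠ N in Filter.atTop, ∃ i : Fin N, ∃ a h : ℝ, 1 / 2 < a ∧ a < 2 ∧ 1 / 2 < h ∧ h < 2 ∧ ∃ z ∈ Literature.MathematicalPhysics.StatisticalMechanics.hcpStacking a h, ∃ A : EuclideanSpace ℝ (Fin 3) →ₗᵢ[ℝ] EuclideanSpace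 ℝ (Fin 3), (∀ p ∈ Literature.MathematicalPhysics.StatisticalMechanics.hcpStacking a h, dist p z ≤ R → ∃ j : Fin N, dist (x N j) (x N i + A (p - z)) ≤ ε) ∧ (∀ j : Fin N, dist (x N j) (x N i) ≤ R → ∃ p ∈ Literature.MathematicalPhysics.StatisticalMechanics.hcpStacking a h, dist (x N j) (x N i + A (p - z)) ≤ ε)

/-- item stmt-AtomisticToContinuum-4555 · support · rank 9 · closed · moot by None · by planner
sources: BlancLewin2015
[support] SOFT ASSEMBLY LEMMA (replaces the single-P hinge 0751/0752): if for all R, ε every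
ground-state sequence eventually has one particle with an (R, ε)-hcp window, then (with the uniform
minimal distance of LJ ground states) IsCrystallizing lennardJones 3: centre at that particle (τ =
−x_i), diagonalise over R_k = k, ε_k = 1/k, extract convergent (a, h) ∈ [1/2,2]², isometries A in
O(3) and the finitely many pointed patterns hcpStacking − z; minimal distance makes the ε-matching a
bijection on supp f, so Σ_i f(x_i + τ) → Σ over the isometric image of hcpPeriodicConfiguration a h
(a PeriodicConfiguration, m ≡ 1). Blanc–Lewin (16) is local, so one window per N suffices.
[difficulty: M] -/
@[route_item "route-AtomisticToContinuum-LaminarKissing"]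
def HcpWindowsCrystallize : Prop :=
  (∀ R ε : ℝ, 0 < R → 0 < ε → ε < 1 / 4 → ∀ x : (N : ℕ) → (Fin N → EuclideanSpace ℝ (Fin 3)), (∀ N, Literature.MathematicalPhysics.StatisticalMechanics.IsGroundState Literature.MathematicalPhysics.StatisticalMechanics.lennardJones (x N)) → ∀ᶠ N in Filter.atTop, ∃ i : Fin N, ∃ a h : ℝ, 1 / 2 < a ∧ a < 2 ∧ 1 / 2 < h ∧ h < 2 ∧ ∃ z ∈ Literature.MathematicalPhysics.StatisticalMechanics.hcpStacking a h, ∃ A : EuclideanSpace ℝ (Fin 3) →ₗᵢ[ℝ] EuclideanSpace ℝ (Fin 3), (∀ p ∈ Literature.MathematicalPhysics.StatisticalMechanics.hcpStacking a h, dist p z ≤ R → ∃ j : Fin N, dist (x N j) (x N i + A (p - z)) ≤ ε) ∧ (∀ j : Fin N, dist (x N j) (x N i) ≤ R → ∃ p ∈ Literature.MathematicalPhysics.StatisticalMechanics.hcpStacking a h, dist (x N j) (x N i + A (p - z)) ≤ ε)) → Literature.MathematicalPhysics.StatisticalMechanics.LennardJonesMinimalDistance → Literature.MathematicalPhysics.StatisticalMechanics.IsCrystallizing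 Literature.MathematicalPhysics.StatisticalMechanics.lennardJones 3

/-- item stmt-AtomisticToContinuum-4556 · assembly · rank 1 · closed · moot by None · by planner
sources: BlancLewin2015
[assembly] LaminarBarlowWindows → BarlowToHcpWindows → StackingFaultBound → HcpWindowsCrystallize →
CrysPeriodicMinAttained → CrysEnergyLimit → Crystallization. -/
@[route_item "route-AtomisticToContinuum-LaminarKissing"]
def Assembly : Prop :=
  LaminarBarlowWindows → BarlowToHcpWindows → StackingFaultBound → HcpWindowsCrystallize → CrysPeriodicMinAttained → CrysEnergyLimit → Literature.MathematicalPhysics.StatisticalMechanics.Crystallization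

end Summit.AtomisticToContinuum.Crystallization.Theses.LaminarKissing
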